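import Mathlib
import HarnessLib

/-!
# The branch at infinity of the Fermat curve `x₀ᴺ + x₁ᴺ = 1`

Zilber's Exponential-Algebraic Closedness, case ladder (host summit Schanuel, cell `pub-schanuel`,
seat 2, gen 5).  First (analytic) file towards Mantova–Masser's example (fermat)
[MantovaMasser2023, §1 Further remarks, p. 5]: the surface `{x₀⁹ + x₁⁹ = 1, y₀ + y₁ = 1}`, for which
Zariski density of the exponential points "does not seem obvious".

Near infinity the Fermat curve `x₀ᴺ + x₁ᴺ = 1` (`N ≥ 2`) has the branch
`x₀ = Z(w) := η·w·(1 - w⁻ᴺ)^{1/N}`, `x₁ = w`, `ηᴺ = -1` — a PRINCIPAL power of a number within `1/9`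
of `1`, so there are no branch-cut issues and `Z(w)ᴺ = 1 - wᴺ` holds exactly (`branch_pow_eq`).
Elementary estimates (`‖(1 + ε)^c - 1‖ ≤ 3‖ε‖`): `‖Z(w) - ηw‖ ≤ 1` for `‖w‖ ≥ 3`
(`norm_branch_sub_le`); on the disc `|w - 2πik| ≤ 1`: `Re Z(w) ≤ 2πk·Re(ηi) + 2`, `‖Z(w)‖ ≤ 2πk + 2`
(`re_branch_le`, `norm_branch_le`); `Z` is differentiable with `‖Z'‖ ≤ 5`, hence `5`-Lipschitz on the
disc (`lipschitzOnWith_branch`, mean-value inequality).  Consumed by `ZilberEacFermatEscape`.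

HONEST FRAMING: elementary complex analysis; `EC(3,2)` OPEN; nothing here bears on Schanuel's
conjecture.
-/

noncomputable section

open Complex Filter Topology Metric Set

set_option linter.dupNamespace false

namespace Summit.Schanuel.Schanuel.Theorems

/-! ## Complex powers of numbers near `1` -/

/-- `‖(1 + ε)^c - 1‖ ≤ 3‖ε‖` for `‖ε‖ ≤ 1/2`, `‖c‖ ≤ 1` (principal power). [folklore] -/
theorem norm_one_add_cpow_sub_one_le {ε c : ℂ} (hε : ‖ε‖ ≤ 1 / 2) (hc : ‖c‖ ≤ 1) :
    ‖(1 + ε) ^ c - 1‖ ≤ 3 * ‖ε‖ := by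
  have h1 : 1 + ε ≠ 0 := by
    intro h
    have h' : ε = -1 := by linear_combination h
    rw [h', norm_neg, norm_one] at hε
    norm_num at hε
  have hlog : ‖log (1 + ε)‖ ≤ 3 / 2 * ‖ε‖ := Complex.norm_log_one_add_half_le_self hε
  have hu : ‖log (1 + ε) * c‖ ≤ 1 := by
    rw [norm_mul]
    calc ‖log (1 + ε)‖ * ‖c‖ ≤ 3 / 2 * ‖ε‖ * 1 :=
          mul_le_mul hlog hc (norm_nonneg _) (by positivity)
      _ ≤ 1 := by linarith
  rw [cpow_def_of_ne_zero h1]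
  calc ‖exp (log (1 + ε) * c) - 1‖ ≤ 2 * ‖log (1 + ε) * c‖ := Complex.norm_exp_sub_one_le hu
    _ = 2 * (‖log (1 + ε)‖ * ‖c‖) := by rw [norm_mul]
    _ ≤ 2 * (3 / 2 * ‖ε‖ * 1) := by
        gcongr 2 * ?_
        exact mul_le_mul hlog hc (norm_nonneg _) (by positivity)
    _ = 3 * ‖ε‖ := by ring

/-- `‖(1 + ε)^c‖ ≤ 5/2` for `‖ε‖ ≤ 1/2`, `‖c‖ ≤ 1`. [folklore] -/
theorem norm_one_add_cpow_le {ε c : ℂ} (hε : ‖ε‖ ≤ 1 / 2) (hc : ‖c‖ ≤ 1) :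
    ‖(1 + ε) ^ c‖ ≤ 5 / 2 := by
  have h := norm_one_add_cpow_sub_one_le hε hc
  calc ‖(1 + ε) ^ c‖ = ‖((1 + ε) ^ c - 1) + 1‖ := by rw [sub_add_cancel]
    _ ≤ ‖(1 + ε) ^ c - 1‖ + ‖(1 : ℂ)‖ := norm_add_le _ _
    _ ≤ 3 * ‖ε‖ + 1 := by rw [norm_one]; linarith
    _ ≤ 5 / 2 := by linarith

/-! ## The branch `Z(w) = η w (1 - w⁻ᴺ)^{1/N}` of the Fermat curve at infinity -/

section Branch

variable {N : ℕ} {η : ℂ} {Z : ℂ → ℂ}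

/-- `3‖w‖ ≤ ‖w‖ᴺ` for `‖w‖ ≥ 3`, `N ≥ 2`. [folklore] -/
theorem three_mul_norm_le_norm_pow (hN : 2 ≤ N) {w : ℂ} (hw : 3 ≤ ‖w‖) : 3 * ‖w‖ ≤ ‖w‖ ^ N :=
  calc 3 * ‖w‖ ≤ ‖w‖ * ‖w‖ := by gcongr
    _ = ‖w‖ ^ 2 := by ring
    _ ≤ ‖w‖ ^ N := pow_le_pow_right₀ (by linarith) hN

/-- `‖w⁻ᴺ‖ ≤ 1/(3‖w‖)` for `‖w‖ ≥ 3`, `N ≥ 2`. [folklore] -/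
theorem norm_inv_pow_le (hN : 2 ≤ N) {w : ℂ} (hw : 3 ≤ ‖w‖) : ‖(w ^ N)⁻¹‖ ≤ 1 / (3 * ‖w‖) := by
  rw [norm_inv, norm_pow, ← one_div]
  exact one_div_le_one_div_of_le (by positivity) (three_mul_norm_le_norm_pow hN hw)

/-- `‖w⁻ᴺ‖ ≤ 1/9 (≤ 1/2)` for `‖w‖ ≥ 3`, `N ≥ 2`. [folklore] -/
theorem norm_inv_pow_le_half (hN : 2 ≤ N) {w : ℂ} (hw : 3 ≤ ‖w‖) : ‖-(w ^ N)⁻¹‖ ≤ 1 / 2 := by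
  rw [norm_neg]
  calc ‖(w ^ N)⁻¹‖ ≤ 1 / (3 * ‖w‖) := norm_inv_pow_le hN hw
    _ ≤ 1 / (3 * 3) := by gcongr
    _ ≤ 1 / 2 := by norm_num

/-- `‖N⁻¹‖ ≤ 1`. [folklore] -/
theorem norm_inv_natCast_le (hN : 2 ≤ N) : ‖((N : ℂ)⁻¹)‖ ≤ 1 := by
  rw [norm_inv, Complex.norm_natCast]
  exact inv_le_one_of_one_le₀ (by exact_mod_cast (by omega : 1 ≤ N))

/-- `‖N⁻¹ - 1‖ ≤ 1`. [folklore] -/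
theorem norm_inv_natCast_sub_one_le (hN : 2 ≤ N) : ‖((N : ℂ)⁻¹ - 1)‖ ≤ 1 := by
  have hN' : (2 : ℝ) ≤ N := by exact_mod_cast hN
  have h : ((N : ℂ)⁻¹ - 1) = (((N : ℝ)⁻¹ - 1 : ℝ) : ℂ) := by push_cast; ring
  rw [h, Complex.norm_real, Real.norm_eq_abs, abs_le]
  have h1 : (N : ℝ)⁻¹ ≤ 1 := inv_le_one_of_one_le₀ (by linarith)
  have h2 : 0 ≤ (N : ℝ)⁻¹ := by positivity
  constructor <;> linarith

/-- **The branch lies on the Fermat curve**: `Z(w)ᴺ = 1 - wᴺ` for `w ≠ 0` (`ηᴺ = -1`). [folklore] -/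
theorem branch_pow_eq (hN : 2 ≤ N) (hηN : η ^ N = -1)
    (hZ : ∀ w, Z w = η * w * (1 - (w ^ N)⁻¹) ^ ((N : ℂ)⁻¹)) {w : ℂ} (hw : w ≠ 0) :
    Z w ^ N = 1 - w ^ N := by
  have hwN : w ^ N ≠ 0 := pow_ne_zero _ hw
  rw [hZ, mul_pow, mul_pow, hηN, Complex.cpow_nat_inv_pow _ (by omega : N ≠ 0), mul_sub, mul_one,
    mul_assoc (-1 : ℂ) (w ^ N), mul_inv_cancel₀ hwN]
  ring

/-- **The branch is asymptotic to `η w`**: `‖Z(w) - η w‖ ≤ 1` for `‖w‖ ≥ 3` (`‖η‖ = 1`, `N ≥ 2`).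
[folklore] -/
theorem norm_branch_sub_le (hN : 2 ≤ N) (hη : ‖η‖ = 1)
    (hZ : ∀ w, Z w = η * w * (1 - (w ^ N)⁻¹) ^ ((N : ℂ)⁻¹)) {w : ℂ} (hw : 3 ≤ ‖w‖) :
    ‖Z w - η * w‖ ≤ 1 := by
  have hw0 : 0 < ‖w‖ := by linarith
  have h1 : Z w - η * w = η * w * ((1 + -(w ^ N)⁻¹) ^ ((N : ℂ)⁻¹) - 1) := by
    rw [hZ, sub_eq_add_neg (1 : ℂ)]; ring
  rw [h1, norm_mul, norm_mul, hη, one_mul]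
  calc ‖w‖ * ‖(1 + -(w ^ N)⁻¹) ^ ((N : ℂ)⁻¹) - 1‖ ≤ ‖w‖ * (3 * ‖-(w ^ N)⁻¹‖) := by
        gcongr
        exact norm_one_add_cpow_sub_one_le (norm_inv_pow_le_half hN hw) (norm_inv_natCast_le hN)
    _ = 3 * (‖w‖ * ‖(w ^ N)⁻¹‖) := by rw [norm_neg]; ring
    _ ≤ 3 * (‖w‖ * (1 / (3 * ‖w‖))) := by gcongr; exact norm_inv_pow_le hN hw
    _ = 1 := by field_simp

/-- `‖k·2πi‖ = 2πk`. [folklore] -/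
theorem norm_natCast_mul_two_pi_I (k : ℕ) : ‖(k : ℂ) * (2 * Real.pi * I)‖ = 2 * Real.pi * k := by
  rw [show (2 : ℂ) * (Real.pi : ℂ) * I = ((2 * Real.pi : ℝ) : ℂ) * I by push_cast; ring, norm_mul,
    norm_mul, Complex.norm_natCast, Complex.norm_real, Complex.norm_I, mul_one,
    Real.norm_of_nonneg (by positivity)]
  ring

/-- On the disc `|w - 2πik| ≤ 1` (`k ≥ 1`): `‖w‖ ≥ 3`. [folklore] -/
theorem three_le_norm_of_mem_closedBall {k : ℕ} (hk : 1 ≤ k) {w : ℂ}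
    (hw : w ∈ closedBall ((k : ℂ) * (2 * Real.pi * I)) 1) : 3 ≤ ‖w‖ := by
  rw [mem_closedBall, dist_eq_norm] at hw
  have h1 := norm_sub_norm_le ((k : ℂ) * (2 * Real.pi * I)) w
  rw [norm_natCast_mul_two_pi_I, norm_sub_rev] at h1
  have hk' : (1 : ℝ) ≤ k := by exact_mod_cast hk
  nlinarith [Real.pi_gt_three]

/-- On the disc `|w - 2πik| ≤ 1`: `‖w‖ ≤ 2πk + 1`. [folklore] -/
theorem norm_le_of_mem_closedBall {k : ℕ} {w : ℂ}
    (hw : w ∈ closedBall ((k : ℂ) * (2 * Real.pi * I)) 1) : ‖w‖ ≤ 2 * Real.pi * k + 1 := by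
  rw [mem_closedBall, dist_eq_norm] at hw
  have h1 := norm_sub_norm_le w ((k : ℂ) * (2 * Real.pi * I))
  rw [norm_natCast_mul_two_pi_I] at h1
  linarith

/-- **Real part of the branch on the disc** `|w - 2πik| ≤ 1`, `k ≥ 1`:
`Re Z(w) ≤ 2πk · Re(ηi) + 2`. [folklore] -/
theorem re_branch_le (hN : 2 ≤ N) (hη : ‖η‖ = 1)
    (hZ : ∀ w, Z w = η * w * (1 - (w ^ N)⁻¹) ^ ((N : ℂ)⁻¹)) {k : ℕ} (hk : 1 ≤ k) {w : ℂ}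
    (hw : w ∈ closedBall ((k : ℂ) * (2 * Real.pi * I)) 1) :
    (Z w).re ≤ 2 * Real.pi * k * (η * I).re + 2 := by
  have h3 := three_le_norm_of_mem_closedBall hk hw
  have hsub := norm_branch_sub_le hN hη hZ h3
  rw [mem_closedBall, dist_eq_norm] at hw
  -- `Z w = η·(k·2πi) + η·(w - k·2πi) + (Z w - η w)`
  have hdec : Z w = ((2 * Real.pi * k : ℝ) : ℂ) * (η * I) + η * (w - (k : ℂ) * (2 * Real.pi * I)) +
      (Z w - η * w) := by push_cast; ring
  rw [hdec, add_re, add_re, re_ofReal_mul]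
  have h1 : (η * (w - (k : ℂ) * (2 * Real.pi * I))).re ≤ 1 :=
    (re_le_norm _).trans (by rw [norm_mul, hη, one_mul]; exact hw)
  have h2 : (Z w - η * w).re ≤ 1 := (re_le_norm _).trans hsub
  linarith

/-- **Size of the branch on the disc**: `‖Z(w)‖ ≤ 2πk + 2`. [folklore] -/
theorem norm_branch_le (hN : 2 ≤ N) (hη : ‖η‖ = 1)
    (hZ : ∀ w, Z w = η * w * (1 - (w ^ N)⁻¹) ^ ((N : ℂ)⁻¹)) {k : ℕ} (hk : 1 ≤ k) {w : ℂ}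
    (hw : w ∈ closedBall ((k : ℂ) * (2 * Real.pi * I)) 1) :
    ‖Z w‖ ≤ 2 * Real.pi * k + 2 := by
  have h3 := three_le_norm_of_mem_closedBall hk hw
  have hsub := norm_branch_sub_le hN hη hZ h3
  have hle := norm_le_of_mem_closedBall hw
  calc ‖Z w‖ = ‖(Z w - η * w) + η * w‖ := by rw [sub_add_cancel]
    _ ≤ ‖Z w - η * w‖ + ‖η * w‖ := norm_add_le _ _
    _ ≤ 1 + ‖w‖ := by rw [norm_mul, hη, one_mul]; linarith
    _ ≤ 2 * Real.pi * k + 2 := by linarith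

/-- **Derivative of the branch** (`‖w‖ ≥ 3`). [folklore] -/
theorem hasDerivAt_branch (hN : 2 ≤ N)
    (hZ : ∀ w, Z w = η * w * (1 - (w ^ N)⁻¹) ^ ((N : ℂ)⁻¹)) {w : ℂ} (hw : 3 ≤ ‖w‖) :
    HasDerivAt Z (η * (1 * (1 - (w ^ N)⁻¹) ^ ((N : ℂ)⁻¹) +
      w * (((N : ℂ)⁻¹) * (1 - (w ^ N)⁻¹) ^ (((N : ℂ)⁻¹) - 1) *
        (-(-((N : ℂ) * w ^ (N - 1)) / (w ^ N) ^ 2))))) w := by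
  have hw0 : w ≠ 0 := by
    intro h; rw [h, norm_zero] at hw; norm_num at hw
  have hwN : w ^ N ≠ 0 := pow_ne_zero _ hw0
  have h1 : HasDerivAt (fun y : ℂ => y ^ N) ((N : ℂ) * w ^ (N - 1)) w := hasDerivAt_pow N w
  have h2 : HasDerivAt (fun y : ℂ => (y ^ N)⁻¹) (-((N : ℂ) * w ^ (N - 1)) / (w ^ N) ^ 2) w :=
    h1.inv hwN
  have h3 : HasDerivAt (fun y : ℂ => 1 - (y ^ N)⁻¹) (-(-((N : ℂ) * w ^ (N - 1)) / (w ^ N) ^ 2)) w :=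
    h2.const_sub 1
  have hslit : 1 - (w ^ N)⁻¹ ∈ slitPlane := by
    rw [sub_eq_add_neg]
    exact mem_slitPlane_of_norm_lt_one (by linarith [norm_inv_pow_le_half hN hw])
  have h4 := h3.cpow_const (c := ((N : ℂ)⁻¹)) hslit
  have h5 := (hasDerivAt_id w).mul h4
  have h6 := h5.const_mul η
  have hZ' : Z = fun y => η * (id y * (1 - (y ^ N)⁻¹) ^ ((N : ℂ)⁻¹)) := by
    funext y; rw [hZ, id, mul_assoc]
  rw [hZ']
  exact h6

/-- **Bound for the derivative of the branch**: `‖Z'(w)‖ ≤ 5` for `‖w‖ ≥ 3`. [folklore] -/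
theorem norm_deriv_branch_le (hN : 2 ≤ N) (hη : ‖η‖ = 1) {w : ℂ} (hw : 3 ≤ ‖w‖) :
    ‖η * (1 * (1 - (w ^ N)⁻¹) ^ ((N : ℂ)⁻¹) +
      w * (((N : ℂ)⁻¹) * (1 - (w ^ N)⁻¹) ^ (((N : ℂ)⁻¹) - 1) *
        (-(-((N : ℂ) * w ^ (N - 1)) / (w ^ N) ^ 2))))‖ ≤ 5 := by
  have hw0 : 0 < ‖w‖ := by linarith
  have hε : ‖-(w ^ N)⁻¹‖ ≤ 1 / 2 := norm_inv_pow_le_half hN hw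
  have hA : ‖(1 - (w ^ N)⁻¹) ^ ((N : ℂ)⁻¹)‖ ≤ 5 / 2 := by
    rw [sub_eq_add_neg]; exact norm_one_add_cpow_le hε (norm_inv_natCast_le hN)
  have hB : ‖(1 - (w ^ N)⁻¹) ^ (((N : ℂ)⁻¹) - 1)‖ ≤ 5 / 2 := by
    rw [sub_eq_add_neg (1 : ℂ) ((w ^ N)⁻¹)]
    exact norm_one_add_cpow_le hε (norm_inv_natCast_sub_one_le hN)
  -- `‖w‖ · ‖N w^{N-1} / (w^N)^2‖ = N / ‖w‖^N ≤ 1`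
  obtain ⟨M, rfl⟩ : ∃ M, N = M + 1 := ⟨N - 1, by omega⟩
  have hpowpos : 0 < ‖w‖ ^ (M + 1) := by positivity
  have hC : ‖w‖ * ‖-(-(((M + 1 : ℕ) : ℂ) * w ^ (M + 1 - 1)) / (w ^ (M + 1)) ^ 2)‖ =
      ((M + 1 : ℕ) : ℝ) / ‖w‖ ^ (M + 1) := by
    rw [norm_neg, norm_div, norm_neg, norm_mul, norm_pow, norm_pow, norm_pow, Complex.norm_natCast,
      Nat.add_sub_cancel]
    field_simp
    ring
  have hD : ((M + 1 : ℕ) : ℝ) / ‖w‖ ^ (M + 1) ≤ 1 := by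
    rw [div_le_one hpowpos]
    calc ((M + 1 : ℕ) : ℝ) ≤ (3 : ℝ) ^ (M + 1) := by
          have : M + 1 < 3 ^ (M + 1) :=
            (Nat.lt_two_pow_self).trans_le (Nat.pow_le_pow_left (by norm_num) _)
          exact_mod_cast this.le
      _ ≤ ‖w‖ ^ (M + 1) := pow_le_pow_left₀ (by norm_num) hw _
  rw [norm_mul, hη, one_mul]
  calc ‖1 * (1 - (w ^ (M + 1))⁻¹) ^ (((M + 1 : ℕ) : ℂ)⁻¹) +
        w * ((((M + 1 : ℕ) : ℂ)⁻¹) * (1 - (w ^ (M + 1))⁻¹) ^ ((((M + 1 : ℕ) : ℂ)⁻¹) - 1) *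
          (-(-(((M + 1 : ℕ) : ℂ) * w ^ (M + 1 - 1)) / (w ^ (M + 1)) ^ 2)))‖
      ≤ ‖1 * (1 - (w ^ (M + 1))⁻¹) ^ (((M + 1 : ℕ) : ℂ)⁻¹)‖ +
        ‖w * ((((M + 1 : ℕ) : ℂ)⁻¹) * (1 - (w ^ (M + 1))⁻¹) ^ ((((M + 1 : ℕ) : ℂ)⁻¹) - 1) *
          (-(-(((M + 1 : ℕ) : ℂ) * w ^ (M + 1 - 1)) / (w ^ (M + 1)) ^ 2)))‖ := norm_add_le _ _
    _ ≤ 5 / 2 + 5 / 2 := by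
        gcongr
        · rw [one_mul]; exact hA
        · rw [norm_mul, norm_mul, norm_mul]
          calc ‖w‖ * (‖(((M + 1 : ℕ) : ℂ)⁻¹)‖ * ‖(1 - (w ^ (M + 1))⁻¹) ^ ((((M + 1 : ℕ) : ℂ)⁻¹) - 1)‖ *
                ‖-(-(((M + 1 : ℕ) : ℂ) * w ^ (M + 1 - 1)) / (w ^ (M + 1)) ^ 2)‖)
              = ‖(((M + 1 : ℕ) : ℂ)⁻¹)‖ * ‖(1 - (w ^ (M + 1))⁻¹) ^ ((((M + 1 : ℕ) : ℂ)⁻¹) - 1)‖ *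
                (‖w‖ * ‖-(-(((M + 1 : ℕ) : ℂ) * w ^ (M + 1 - 1)) / (w ^ (M + 1)) ^ 2)‖) := by ring
            _ ≤ 1 * (5 / 2) * 1 := by
                rw [hC]
                gcongr
                · exact norm_inv_natCast_le hN
            _ = 5 / 2 := by ring
    _ = 5 := by norm_num

/-- **The branch is `5`-Lipschitz on the disc** `|w - 2πik| ≤ 1`, `k ≥ 1` (mean-value inequality on a
convex set). [folklore] -/
theorem lipschitzOnWith_branch (hN : 2 ≤ N) (hη : ‖η‖ = 1)
    (hZ : ∀ w, Z w = η * w * (1 - (w ^ N)⁻¹) ^ ((N : ℂ)⁻¹)) {k : ℕ} (hk : 1 ≤ k) :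
    LipschitzOnWith 5 Z (closedBall ((k : ℂ) * (2 * Real.pi * I)) 1) := by
  refine (convex_closedBall _ _).lipschitzOnWith_of_nnnorm_hasDerivWithin_le
    (fun w hw => (hasDerivAt_branch hN hZ (three_le_norm_of_mem_closedBall hk hw)).hasDerivWithinAt)
    (fun w hw => ?_)
  have := norm_deriv_branch_le hN hη (three_le_norm_of_mem_closedBall hk hw)
  rw [← NNReal.coe_le_coe, coe_nnnorm]
  exact_mod_cast this

end Branch

end Summit.Schanuel.Schanuel.Theorems
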